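import Mathlib
import HarnessLib
import Literature.Analysis.FluidPDE.NewtonPotentialHolder
import Summits.NavierStokesRegularity.NavierStokesRegularity.Theorems.ChiralWindowDoorDefs
import Summits.NavierStokesRegularity.NavierStokesRegularity.Theorems.CriticalFluxDoorDefs
import Summits.NavierStokesRegularity.NavierStokesRegularity.Theorems.ChiralWindowDoorLambda
import Summits.NavierStokesRegularity.NavierStokesRegularity.Theorems.CriticalFluxDoorLambdaDecay
import Summits.NavierStokesRegularity.NavierStokesRegularity.Theorems.CriticalFluxDoorLambdaDeriv

/-!
# Door S21-C «CriticalFluxDoor» — `Λ` IS SYMMETRIC and THE COMMUTATOR DECOMPOSITION `Λ(a v) = aΛv + [Λ,a]v`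
# (F3 plumbing E7, E9)

Door S21-C of nsreg-p1's local Type-I door family (`HOME/ns-regularity-ideate-p1/ROUND-20.md`; DESIGN-ONLY, route NOT born).
The `d/dt Q(a_R, v)` identity of F3 (F3-DERIVATION §1) moves `Λ` from `∂ₜv` onto `a_R v` and splits off the commutator:

* E7 `inner_fracLapHalf_eq_integral`, `integral_inner_secondDiff_comm`, `integral_inner_fracLapHalf_comm` — **`Λ` is
  symmetric**: `∫⟪Λf, g⟫ = ∫⟪f, Λg⟫` for `f ∈ C²_c`, `g ∈ C²_b` (Fubini twice; the `(z,x)`-Tonelli majorant uses the compact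
  support of `f`, the `(x,z)` one the `x`-uniform majorant `derivDom` of `g`);
* E9 `integrable_commutatorIntegrand`, `fracLapHalf_smul_eq` — **`Λ(a v)(x) = a(x)Λv(x) + ½∫K(z)[(a(x)−a(x+z))v(x+z) +
  (a(x)−a(x−z))v(x−z)]dz`** for `a ∈ C²_c`, `v ∈ C²_b` (the commutator integral converges as the difference of two convergent
  ones); `fracLapHalf_smul_eq_lamComm` — the same with the tree's name `lamComm a v` (`…CriticalFluxDoorDefs`).

Proofs: nsreg-p1 g17 (`r20/LambdaDecay.lean` v5 §§E7, E9, farm rc 0), landed by nsreg-p6 g13.  Seat nsreg-p6 g13 (THEOREMS-ONLY door sequels, DIRECTOR-NS g8 #32 (2)/#36).  WHAT THIS IS NOT: not NS regularity (Clay A); kernel calculus only; no route is opened.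
-/

noncomputable section

-- the summit and its single sub-problem share the name (CONVENTIONS §1), as in every Theorems file
set_option linter.dupNamespace false

namespace Summit.NavierStokesRegularity.NavierStokesRegularity.Theorems.CriticalFluxDoorLambdaSymmetry

open MeasureTheory Metric Set Filter Topology Function
open Literature.Analysis Literature.Analysis.FluidPDE
open Summit.NavierStokesRegularity.NavierStokesRegularity.Theorems.ChiralWindowDoorDefs
open Summit.NavierStokesRegularity.NavierStokesRegularity.Theorems.CriticalFluxDoorDefs
open Summit.NavierStokesRegularity.NavierStokesRegularity.Theorems.ChiralWindowDoorLambda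
  (integrable_fracLapHalf_integrand_of_contDiff lamK_mul_sq_le)
open Summit.NavierStokesRegularity.NavierStokesRegularity.Theorems.CriticalFluxDoorLambdaDecay
open Summit.NavierStokesRegularity.NavierStokesRegularity.Theorems.CriticalFluxDoorLambdaDeriv

/-! ## E7 — `Λ` IS SYMMETRIC: `∫⟪Λf, g⟫ = ∫⟪f, Λg⟫` for `f ∈ C²_c`, `g ∈ C²_b` (F3's `d/dt Q(a_R,v)` moves `Λ` from
`∂ₜv` onto `a_R v`; Fubini twice — the `(z,x)`-Tonelli majorant uses the compact support of `f`, the `(x,z)` one the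
`x`-uniform majorant `derivDom` of `g`). -/

/-- `⟪c, Λf(x)⟫ = ½∫ K(z)⟪c, 2f(x) − f(x+z) − f(x−z)⟫dz` (inner product through the Bochner integral). -/
theorem inner_fracLapHalf_eq_integral {f : EuclideanSpace ℝ (Fin 3) → EuclideanSpace ℝ (Fin 3)} (hf : ContDiff ℝ 2 f) {M₀ M₂ : ℝ} (h0 : ∀ y, ‖f y‖ ≤ M₀)
    (h2 : ∀ y, ‖iteratedFDeriv ℝ 2 f y‖ ≤ M₂) (c x : EuclideanSpace ℝ (Fin 3)) :
    inner ℝ c (fracLapHalf f x) =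
      (1 / 2 : ℝ) * ∫ z, lamK z * inner ℝ c ((2 : ℝ) • f x - f (x + z) - f (x - z)) := by
  unfold fracLapHalf
  rw [real_inner_smul_right, ← integral_inner (integrable_fracLapHalf_integrand_of_contDiff hf h0 h2 x) c]
  congr 1
  refine integral_congr_ae (ae_of_all _ fun z => ?_)
  simp only [real_inner_smul_right]

/-- Translation invariance moves the second difference across the pairing (fixed `z`). -/
theorem integral_inner_secondDiff_comm {f g : EuclideanSpace ℝ (Fin 3) → EuclideanSpace ℝ (Fin 3)} (hfc : Continuous f) (hfi : Integrable f)
    (hgc : Continuous g) {N₀ : ℝ} (k0 : ∀ x, ‖g x‖ ≤ N₀) (z : EuclideanSpace ℝ (Fin 3)) :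
    ∫ x, inner ℝ (g x) ((2 : ℝ) • f x - f (x + z) - f (x - z)) =
      ∫ x, inner ℝ (f x) ((2 : ℝ) • g x - g (x + z) - g (x - z)) := by
  have hN₀ : 0 ≤ N₀ := le_trans (norm_nonneg _) (k0 0)
  -- integrability of the six pairings
  have hint : ∀ (φ ψ : EuclideanSpace ℝ (Fin 3) → EuclideanSpace ℝ (Fin 3)), Continuous φ → Continuous ψ → Integrable φ → (∀ x, ‖ψ x‖ ≤ N₀) →
      Integrable (fun x => inner ℝ (ψ x) (φ x)) ∧ Integrable (fun x => inner ℝ (φ x) (ψ x)) := by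
    intro φ ψ hφ hψ hφi hψ0
    have hm : Integrable (fun x => N₀ * ‖φ x‖) := hφi.norm.const_mul N₀
    refine ⟨hm.mono' (hψ.inner hφ).aestronglyMeasurable (ae_of_all _ fun x => ?_),
      hm.mono' (hφ.inner hψ).aestronglyMeasurable (ae_of_all _ fun x => ?_)⟩
    · rw [Real.norm_eq_abs]
      exact (abs_real_inner_le_norm _ _).trans (mul_le_mul_of_nonneg_right (hψ0 x) (norm_nonneg _))
    · rw [Real.norm_eq_abs, mul_comm]
      exact (abs_real_inner_le_norm _ _).trans (mul_le_mul_of_nonneg_left (hψ0 x) (norm_nonneg _))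
  have hfa : Continuous fun x => f (x + z) := hfc.comp (continuous_id.add continuous_const)
  have hfs : Continuous fun x => f (x - z) := hfc.comp (continuous_id.sub continuous_const)
  have hga : Continuous fun x => g (x + z) := hgc.comp (continuous_id.add continuous_const)
  have hgs : Continuous fun x => g (x - z) := hgc.comp (continuous_id.sub continuous_const)
  have i1 := (hint f g hfc hgc hfi k0).1
  have j1 := (hint f g hfc hgc hfi k0).2
  have i2 := (hint _ g hfa hgc (hfi.comp_add_right z) k0).1
  have i3 := (hint _ g hfs hgc (hfi.comp_sub_right z) k0).1
  have j2 := (hint f _ hfc hga hfi (fun x => k0 (x + z))).2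
  have j3 := (hint f _ hfc hgs hfi (fun x => k0 (x - z))).2
  have eL : ∀ x, inner ℝ (g x) ((2 : ℝ) • f x - f (x + z) - f (x - z)) =
      2 * inner ℝ (g x) (f x) - inner ℝ (g x) (f (x + z)) - inner ℝ (g x) (f (x - z)) := fun x => by
    rw [inner_sub_right, inner_sub_right, real_inner_smul_right]
  have eR : ∀ x, inner ℝ (f x) ((2 : ℝ) • g x - g (x + z) - g (x - z)) =
      2 * inner ℝ (f x) (g x) - inner ℝ (f x) (g (x + z)) - inner ℝ (f x) (g (x - z)) := fun x => by
    rw [inner_sub_right, inner_sub_right, real_inner_smul_right]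
  simp_rw [eL, eR]
  have i1' : Integrable (fun x => 2 * inner ℝ (g x) (f x)) := i1.const_mul 2
  have j1' : Integrable (fun x => 2 * inner ℝ (f x) (g x)) := j1.const_mul 2
  have i12 : Integrable (fun x => 2 * inner ℝ (g x) (f x) - inner ℝ (g x) (f (x + z))) := i1'.sub i2
  have j12 : Integrable (fun x => 2 * inner ℝ (f x) (g x) - inner ℝ (f x) (g (x + z))) := j1'.sub j2
  rw [integral_sub i12 i3, integral_sub i1' i2, integral_sub j12 j3, integral_sub j1' j2,
    integral_const_mul, integral_const_mul]
  -- translate the two shifted pairings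
  have t2 : ∫ x, inner ℝ (g x) (f (x + z)) = ∫ x, inner ℝ (f x) (g (x - z)) := by
    have : (fun x => inner ℝ (g x) (f (x + z))) = fun x => (fun y => inner ℝ (f y) (g (y - z))) (x + z) := by
      funext x; simp only [add_sub_cancel_right, real_inner_comm]
    rw [this, integral_add_right_eq_self (fun y => inner ℝ (f y) (g (y - z))) z]
  have t3 : ∫ x, inner ℝ (g x) (f (x - z)) = ∫ x, inner ℝ (f x) (g (x + z)) := by
    have : (fun x => inner ℝ (g x) (f (x - z))) = fun x => (fun y => inner ℝ (f y) (g (y + z))) (x - z) := by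
      funext x; simp only [sub_add_cancel, real_inner_comm]
    rw [this, integral_sub_right_eq_self (fun y => inner ℝ (f y) (g (y + z))) z]
  have t1 : ∫ x, inner ℝ (g x) (f x) = ∫ x, inner ℝ (f x) (g x) :=
    integral_congr_ae (ae_of_all _ fun x => real_inner_comm _ _)
  rw [t1, t2, t3]
  ring

/-- **`Λ` is symmetric**: `∫⟪Λf, g⟫ = ∫⟪f, Λg⟫` for `f ∈ C²` compactly supported and `g ∈ C²` with `g, D²g` bounded. -/
theorem integral_inner_fracLapHalf_comm {f g : EuclideanSpace ℝ (Fin 3) → EuclideanSpace ℝ (Fin 3)} (hf : ContDiff ℝ 2 f) (hfs : HasCompactSupport f)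
    {M₂ : ℝ} (h2 : ∀ y, ‖iteratedFDeriv ℝ 2 f y‖ ≤ M₂) (hg : ContDiff ℝ 2 g) {N₀ N₂ : ℝ}
    (k0 : ∀ y, ‖g y‖ ≤ N₀) (k2 : ∀ y, ‖iteratedFDeriv ℝ 2 g y‖ ≤ N₂) :
    ∫ x, inner ℝ (fracLapHalf f x) (g x) = ∫ x, inner ℝ (f x) (fracLapHalf g x) := by
  obtain ⟨M₀, h0⟩ := hf.continuous.bounded_above_of_compact_support hfs
  obtain ⟨ρ, hρ, hfρ⟩ := hfs.exists_pos_le_norm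
  have hfc : Continuous f := hf.continuous
  have hgc : Continuous g := hg.continuous
  have hfi : Integrable f := hfc.integrable_of_hasCompactSupport hfs
  have hN₀ : 0 ≤ N₀ := le_trans (norm_nonneg _) (k0 0)
  have hM₂ : 0 ≤ M₂ := le_trans (norm_nonneg _) (h2 0)
  have hM₂' : ∀ y, ‖fderiv ℝ (fderiv ℝ f) y‖ ≤ M₂ := fun y => by
    rw [← norm_iteratedFDeriv_one (𝕜 := ℝ) (fderiv ℝ f), norm_iteratedFDeriv_fderiv]; exact h2 y
  set H₁ : EuclideanSpace ℝ (Fin 3) → EuclideanSpace ℝ (Fin 3) → ℝ := fun x z => lamK z * inner ℝ (g x) ((2 : ℝ) • f x - f (x + z) - f (x - z)) with hH₁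
  set H₂ : EuclideanSpace ℝ (Fin 3) → EuclideanSpace ℝ (Fin 3) → ℝ := fun x z => lamK z * inner ℝ (f x) ((2 : ℝ) • g x - g (x + z) - g (x - z)) with hH₂
  -- Step A: both pairings as iterated integrals
  have hA1 : ∀ x, inner ℝ (fracLapHalf f x) (g x) = (1 / 2 : ℝ) * ∫ z, H₁ x z := fun x => by
    rw [real_inner_comm (g x) (fracLapHalf f x)]
    exact inner_fracLapHalf_eq_integral hf h0 h2 (g x) x
  have hA2 : ∀ x, inner ℝ (f x) (fracLapHalf g x) = (1 / 2 : ℝ) * ∫ z, H₂ x z := fun x =>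
    inner_fracLapHalf_eq_integral hg k0 k2 (f x) x
  -- crude second-difference bound and the pointwise kernel bounds
  have htri : ∀ (φ : EuclideanSpace ℝ (Fin 3) → EuclideanSpace ℝ (Fin 3)) (x z : EuclideanSpace ℝ (Fin 3)),
      ‖(2 : ℝ) • φ x - φ (x + z) - φ (x - z)‖ ≤ 2 * ‖φ x‖ + ‖φ (x + z)‖ + ‖φ (x - z)‖ := by
    intro φ x z
    have e1 := norm_sub_le ((2 : ℝ) • φ x - φ (x + z)) (φ (x - z))
    have e2 := norm_sub_le ((2 : ℝ) • φ x) (φ (x + z))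
    have e3 : ‖(2 : ℝ) • φ x‖ = 2 * ‖φ x‖ := by
      rw [norm_smul, Real.norm_eq_abs, abs_of_pos (by norm_num : (0 : ℝ) < 2)]
    linarith
  have hH₁le : ∀ x z, ‖H₁ x z‖ ≤ lamK z * (N₀ * ‖(2 : ℝ) • f x - f (x + z) - f (x - z)‖) := by
    intro x z
    simp only [hH₁]
    rw [norm_mul, Real.norm_eq_abs, abs_of_nonneg (lamK_nonneg z), Real.norm_eq_abs]
    refine mul_le_mul_of_nonneg_left ?_ (lamK_nonneg z)
    exact (abs_real_inner_le_norm _ _).trans (mul_le_mul_of_nonneg_right (k0 x) (norm_nonneg _))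
  -- Step D: `H₂` is integrable on the product (majorant `‖f(x)‖ · derivDom(z)`)
  have hH₂m : Measurable (uncurry H₂) := by
    have hc : Continuous fun p : EuclideanSpace ℝ (Fin 3) × EuclideanSpace ℝ (Fin 3) =>
        inner ℝ (f p.1) ((2 : ℝ) • g p.1 - g (p.1 + p.2) - g (p.1 - p.2)) :=
      (hfc.comp continuous_fst).inner ((((hgc.comp continuous_fst).const_smul (2 : ℝ)).sub
        (hgc.comp (continuous_fst.add continuous_snd))).sub (hgc.comp (continuous_fst.sub continuous_snd)))
    exact (measurable_lamK.comp measurable_snd).mul hc.measurable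
  have hH₂i : Integrable (uncurry H₂) (volume.prod volume) := by
    have hmaj : Integrable (fun p : EuclideanSpace ℝ (Fin 3) × EuclideanSpace ℝ (Fin 3) => ‖f p.1‖ * derivDom N₀ N₂ p.2) (volume.prod volume) :=
      hfi.norm.mul_prod (integrable_derivDom N₀ N₂)
    refine hmaj.mono' hH₂m.aestronglyMeasurable (ae_of_all _ fun p => ?_)
    have hb := norm_integrand_le_derivDom hg k0 k2 p.1 p.2
    rw [norm_smul, Real.norm_eq_abs, abs_of_nonneg (lamK_nonneg _)] at hb
    simp only [uncurry, hH₂]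
    rw [norm_mul, Real.norm_eq_abs, abs_of_nonneg (lamK_nonneg _), Real.norm_eq_abs]
    calc lamK p.2 * |inner ℝ (f p.1) ((2 : ℝ) • g p.1 - g (p.1 + p.2) - g (p.1 - p.2))|
        ≤ lamK p.2 * (‖f p.1‖ * ‖(2 : ℝ) • g p.1 - g (p.1 + p.2) - g (p.1 - p.2)‖) :=
          mul_le_mul_of_nonneg_left (abs_real_inner_le_norm _ _) (lamK_nonneg _)
      _ = ‖f p.1‖ * (lamK p.2 * ‖(2 : ℝ) • g p.1 - g (p.1 + p.2) - g (p.1 - p.2)‖) := by ring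
      _ ≤ ‖f p.1‖ * derivDom N₀ N₂ p.2 := mul_le_mul_of_nonneg_left hb (norm_nonneg _)
  -- Step E: `H₁` is integrable on the product — Tonelli in the order (z outer, x inner)
  set I₀ : ℝ := ∫ x, ‖f x‖ with hI₀
  set V : ℝ := (volume : Measure (EuclideanSpace ℝ (Fin 3))).real (ball 0 (ρ + 1)) with hV
  have hI₀0 : 0 ≤ I₀ := integral_nonneg fun x => norm_nonneg _
  have hV0 : 0 ≤ V := measureReal_nonneg
  have hPm : Measurable (fun p : EuclideanSpace ℝ (Fin 3) × EuclideanSpace ℝ (Fin 3) => H₁ p.2 p.1) := by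
    have hc : Continuous fun p : EuclideanSpace ℝ (Fin 3) × EuclideanSpace ℝ (Fin 3) =>
        inner ℝ (g p.2) ((2 : ℝ) • f p.2 - f (p.2 + p.1) - f (p.2 - p.1)) :=
      (hgc.comp continuous_snd).inner ((((hfc.comp continuous_snd).const_smul (2 : ℝ)).sub
        (hfc.comp (continuous_snd.add continuous_fst))).sub (hfc.comp (continuous_snd.sub continuous_fst)))
    exact (measurable_lamK.comp measurable_fst).mul hc.measurable
  have hsec : ∀ z, Integrable (fun x => H₁ x z) := by
    intro z
    have hm : Integrable (fun x => lamK z * (N₀ * (2 * ‖f x‖ + ‖f (x + z)‖ + ‖f (x - z)‖))) :=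
      ((((hfi.norm.const_mul 2).add (hfi.comp_add_right z).norm).add
        (hfi.comp_sub_right z).norm).const_mul N₀).const_mul (lamK z)
    have hc : Continuous fun x => H₁ x z := by
      simp only [hH₁]
      exact continuous_const.mul (hgc.inner (((hfc.const_smul (2 : ℝ)).sub
        (hfc.comp (continuous_id.add continuous_const))).sub (hfc.comp (continuous_id.sub continuous_const))))
    refine hm.mono' hc.aestronglyMeasurable (ae_of_all _ fun x => (hH₁le x z).trans ?_)
    exact mul_le_mul_of_nonneg_left (mul_le_mul_of_nonneg_left (htri f x z) hN₀) (lamK_nonneg z)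
  have hrow : ∀ z, ∫ x, ‖H₁ x z‖ ≤ N₀ * derivDom I₀ (M₂ * V) z := by
    intro z
    by_cases hz : ‖z‖ < 1
    · -- near: second difference `≤ 2M₂‖z‖²`, supported in `B_{ρ+1}`
      have hzb : z ∈ ball (0 : EuclideanSpace ℝ (Fin 3)) 1 := mem_ball_zero_iff.2 hz
      have hzc : z ∉ (ball (0 : EuclideanSpace ℝ (Fin 3)) 1)ᶜ := fun h => h hzb
      have hpt : ∀ x, ‖H₁ x z‖ ≤
          lamK z * (N₀ * (ball (0 : EuclideanSpace ℝ (Fin 3)) (ρ + 1)).indicator (fun _ => 2 * M₂ * ‖z‖ ^ 2) x) := by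
        intro x
        refine (hH₁le x z).trans (mul_le_mul_of_nonneg_left (mul_le_mul_of_nonneg_left ?_ hN₀) (lamK_nonneg z))
        by_cases hx : x ∈ ball (0 : EuclideanSpace ℝ (Fin 3)) (ρ + 1)
        · rw [indicator_of_mem hx]
          exact norm_secondDiff_le_local hf (r := ‖z‖) (fun y _ => hM₂' y) le_rfl
        · rw [indicator_of_notMem hx]
          have hx' : ρ + 1 ≤ ‖x‖ := by rwa [mem_ball_zero_iff, not_lt] at hx
          have h1 : f x = 0 := hfρ x (by linarith)
          have h2 : f (x + z) = 0 := hfρ _ (by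
            have := norm_sub_norm_le x (-z)
            rw [sub_neg_eq_add, norm_neg] at this
            linarith [abs_le.1 (abs_norm_sub_norm_le x (x + z))])
          have h3 : f (x - z) = 0 := hfρ _ (by
            have := norm_sub_le_norm_sub_add_norm_sub x (x - z) 0
            linarith [norm_sub_norm_le x z, show ‖x - (x - z)‖ = ‖z‖ by rw [sub_sub_cancel]])
          rw [h1, h2, h3]; simp
      have hmi : Integrable (fun x => lamK z * (N₀ * (ball (0 : EuclideanSpace ℝ (Fin 3)) (ρ + 1)).indicator
          (fun _ => 2 * M₂ * ‖z‖ ^ 2) x)) :=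
        (((integrable_indicator_iff measurableSet_ball).2
          (integrableOn_const measure_ball_lt_top.ne)).const_mul N₀).const_mul (lamK z)
      calc ∫ x, ‖H₁ x z‖ ≤ ∫ x, lamK z * (N₀ * (ball (0 : EuclideanSpace ℝ (Fin 3)) (ρ + 1)).indicator (fun _ => 2 * M₂ * ‖z‖ ^ 2) x) :=
            integral_mono_of_nonneg (ae_of_all _ fun x => norm_nonneg _) hmi (ae_of_all _ hpt)
        _ = lamK z * (N₀ * (V * (2 * M₂ * ‖z‖ ^ 2))) := by
            rw [integral_const_mul, integral_const_mul, integral_indicator_const _ measurableSet_ball, smul_eq_mul, ← hV]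
        _ = N₀ * (lamK z * ((2 * (M₂ * V)) * ‖z‖ ^ 2)) := by ring
        _ ≤ N₀ * ((1 / Real.pi ^ 2 * (2 * (M₂ * V))) * ‖z‖ ^ (-(2 : ℝ))) :=
            mul_le_mul_of_nonneg_left (lamK_mul_sq_le (by positivity) z) hN₀
        _ = N₀ * derivDom I₀ (M₂ * V) z := by
            unfold derivDom; rw [indicator_of_mem hzb, indicator_of_notMem hzc, add_zero]
    · -- far: crude bound, three translates of `‖f‖`
      push Not at hz
      have hzpos : 0 < ‖z‖ := one_pos.trans_le hz
      have hzc : z ∈ (ball (0 : EuclideanSpace ℝ (Fin 3)) 1)ᶜ := by rw [mem_compl_iff, mem_ball_zero_iff]; exact not_lt.2 hz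
      have hzb : z ∉ ball (0 : EuclideanSpace ℝ (Fin 3)) 1 := hzc
      have hmi : Integrable (fun x => lamK z * (N₀ * (2 * ‖f x‖ + ‖f (x + z)‖ + ‖f (x - z)‖))) :=
        ((((hfi.norm.const_mul 2).add (hfi.comp_add_right z).norm).add
          (hfi.comp_sub_right z).norm).const_mul N₀).const_mul (lamK z)
      have hpt : ∀ x, ‖H₁ x z‖ ≤ lamK z * (N₀ * (2 * ‖f x‖ + ‖f (x + z)‖ + ‖f (x - z)‖)) := fun x =>
        (hH₁le x z).trans (mul_le_mul_of_nonneg_left (mul_le_mul_of_nonneg_left (htri f x z) hN₀) (lamK_nonneg z))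
      have hK : lamK z = 1 / Real.pi ^ 2 * ‖z‖ ^ (-(4 : ℝ)) := lamK_eq_rpow (norm_pos_iff.1 hzpos)
      calc ∫ x, ‖H₁ x z‖ ≤ ∫ x, lamK z * (N₀ * (2 * ‖f x‖ + ‖f (x + z)‖ + ‖f (x - z)‖)) :=
            integral_mono_of_nonneg (ae_of_all _ fun x => norm_nonneg _) hmi (ae_of_all _ hpt)
        _ = lamK z * (N₀ * (2 * I₀ + I₀ + I₀)) := by
            have a1 : Integrable (fun x => 2 * ‖f x‖) := hfi.norm.const_mul 2
            have a2 : Integrable (fun x => ‖f (x + z)‖) := (hfi.comp_add_right z).norm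
            have a3 : Integrable (fun x => ‖f (x - z)‖) := (hfi.comp_sub_right z).norm
            have a12 : Integrable (fun x => 2 * ‖f x‖ + ‖f (x + z)‖) := a1.add a2
            rw [integral_const_mul, integral_const_mul, integral_add a12 a3, integral_add a1 a2,
              integral_const_mul, integral_add_right_eq_self (fun x => ‖f x‖) z,
              integral_sub_right_eq_self (fun x => ‖f x‖) z]
        _ = N₀ * ((1 / Real.pi ^ 2 * (4 * I₀)) * ‖z‖ ^ (-(4 : ℝ))) := by rw [hK]; ring
        _ = N₀ * derivDom I₀ (M₂ * V) z := by
            unfold derivDom; rw [indicator_of_notMem hzb, indicator_of_mem hzc, zero_add]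
  have hP : Integrable (fun p : EuclideanSpace ℝ (Fin 3) × EuclideanSpace ℝ (Fin 3) => H₁ p.2 p.1) (volume.prod volume) := by
    rw [integrable_prod_iff hPm.aestronglyMeasurable]
    refine ⟨ae_of_all _ fun z => hsec z, ?_⟩
    refine ((integrable_derivDom I₀ (M₂ * V)).const_mul N₀).mono'
      hPm.aestronglyMeasurable.norm.integral_prod_right' (ae_of_all _ fun z => ?_)
    rw [Real.norm_of_nonneg (integral_nonneg fun x => norm_nonneg _)]
    exact hrow z
  have hH₁i : Integrable (uncurry H₁) (volume.prod volume) := by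
    have : uncurry H₁ = (fun p : EuclideanSpace ℝ (Fin 3) × EuclideanSpace ℝ (Fin 3) => H₁ p.2 p.1) ∘ Prod.swap := by funext p; rfl
    rw [this]; exact hP.swap
  -- Step C: the inner `x`-integrals agree for every `z`
  have hC : ∀ z, ∫ x, H₁ x z = ∫ x, H₂ x z := by
    intro z
    simp only [hH₁, hH₂]
    rw [integral_const_mul, integral_const_mul, integral_inner_secondDiff_comm hfc hfi hgc k0 z]
  -- Step F: assemble
  calc ∫ x, inner ℝ (fracLapHalf f x) (g x) = ∫ x, (1 / 2 : ℝ) * ∫ z, H₁ x z :=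
        integral_congr_ae (ae_of_all _ hA1)
    _ = (1 / 2 : ℝ) * ∫ x, ∫ z, H₁ x z := integral_const_mul _ _
    _ = (1 / 2 : ℝ) * ∫ z, ∫ x, H₁ x z := by rw [integral_integral_swap hH₁i]
    _ = (1 / 2 : ℝ) * ∫ z, ∫ x, H₂ x z := by
        congr 1; exact integral_congr_ae (ae_of_all _ hC)
    _ = (1 / 2 : ℝ) * ∫ x, ∫ z, H₂ x z := by rw [integral_integral_swap hH₂i]
    _ = ∫ x, (1 / 2 : ℝ) * ∫ z, H₂ x z := (integral_const_mul _ _).symm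
    _ = ∫ x, inner ℝ (f x) (fracLapHalf g x) := integral_congr_ae (ae_of_all _ fun x => (hA2 x).symm)

/-! ## E9 — THE COMMUTATOR DECOMPOSITION `Λ(a v) = a Λv + [Λ,a]v` with
`[Λ,a]v(x) = ½∫K(z)[(a(x)−a(x+z))v(x+z) + (a(x)−a(x−z))v(x−z)]dz` for `a ∈ C²_c` (scalar), `v ∈ C²_b`
(F3's commutator term and S20's B3; the commutator integral converges as the difference of two convergent ones). -/

/-- the commutator integrand is integrable (difference of the `Λ(a v)` and `a Λv` integrands). -/
theorem integrable_commutatorIntegrand {a : EuclideanSpace ℝ (Fin 3) → ℝ} {v : EuclideanSpace ℝ (Fin 3) → EuclideanSpace ℝ (Fin 3)} (ha : ContDiff ℝ 2 a)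
    (hac : HasCompactSupport a) (hv : ContDiff ℝ 2 v) {N₀ N₂ : ℝ} (k0 : ∀ y, ‖v y‖ ≤ N₀)
    (k2 : ∀ y, ‖iteratedFDeriv ℝ 2 v y‖ ≤ N₂) (x : EuclideanSpace ℝ (Fin 3)) :
    Integrable (fun z => lamK z • ((a x - a (x + z)) • v (x + z) + (a x - a (x - z)) • v (x - z))) := by
  have hprod : ContDiff ℝ 2 (fun y => a y • v y) := ha.smul hv
  have hps : HasCompactSupport (fun y => a y • v y) := hac.smul_right
  obtain ⟨P₀, hP₀⟩ := hprod.continuous.bounded_above_of_compact_support hps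
  obtain ⟨P₂, hP₂⟩ :=
    (hprod.continuous_iteratedFDeriv (m := 2) le_rfl).bounded_above_of_compact_support (hps.iteratedFDeriv 2)
  have I1 : Integrable (fun z => lamK z • ((2 : ℝ) • (a x • v x) - a (x + z) • v (x + z) - a (x - z) • v (x - z))) :=
    integrable_fracLapHalf_integrand_of_contDiff hprod hP₀ hP₂ x
  have I2 : Integrable (fun z => a x • (lamK z • ((2 : ℝ) • v x - v (x + z) - v (x - z)))) :=
    (integrable_fracLapHalf_integrand_of_contDiff hv k0 k2 x).smul (a x)
  refine (I1.sub I2).congr (ae_of_all _ fun z => ?_)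
  simp only [Pi.sub_apply]
  module

/-- **`Λ(a v)(x) = a(x)Λv(x) + ½∫K(z)[(a(x)−a(x+z))v(x+z) + (a(x)−a(x−z))v(x−z)]dz`** for `a ∈ C²` compactly
supported and `v ∈ C²` with `v, D²v` bounded. -/
theorem fracLapHalf_smul_eq {a : EuclideanSpace ℝ (Fin 3) → ℝ} {v : EuclideanSpace ℝ (Fin 3) → EuclideanSpace ℝ (Fin 3)} (ha : ContDiff ℝ 2 a) (hac : HasCompactSupport a)
    (hv : ContDiff ℝ 2 v) {N₀ N₂ : ℝ} (k0 : ∀ y, ‖v y‖ ≤ N₀) (k2 : ∀ y, ‖iteratedFDeriv ℝ 2 v y‖ ≤ N₂) (x : EuclideanSpace ℝ (Fin 3)) :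
    fracLapHalf (fun y => a y • v y) x = a x • fracLapHalf v x +
      (1 / 2 : ℝ) • ∫ z, lamK z • ((a x - a (x + z)) • v (x + z) + (a x - a (x - z)) • v (x - z)) := by
  have I2 : Integrable (fun z => a x • (lamK z • ((2 : ℝ) • v x - v (x + z) - v (x - z)))) :=
    (integrable_fracLapHalf_integrand_of_contDiff hv k0 k2 x).smul (a x)
  have I3 := integrable_commutatorIntegrand ha hac hv k0 k2 x
  have hpt : ∀ z, lamK z • ((2 : ℝ) • (a x • v x) - a (x + z) • v (x + z) - a (x - z) • v (x - z)) =
      a x • (lamK z • ((2 : ℝ) • v x - v (x + z) - v (x - z))) +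
        lamK z • ((a x - a (x + z)) • v (x + z) + (a x - a (x - z)) • v (x - z)) := fun z => by module
  unfold fracLapHalf
  simp_rw [hpt]
  rw [integral_add I2 I3, integral_smul, smul_add, smul_comm (a x) (1 / 2 : ℝ)]

/-- **`Λ(a v) = aΛv + [Λ,a]v`** with the tree's name `lamComm a v` for the commutator (`…CriticalFluxDoorDefs.lamComm`). -/
theorem fracLapHalf_smul_eq_lamComm {a : EuclideanSpace ℝ (Fin 3) → ℝ} {v : EuclideanSpace ℝ (Fin 3) → EuclideanSpace ℝ (Fin 3)} (ha : ContDiff ℝ 2 a) (hac : HasCompactSupport a)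
    (hv : ContDiff ℝ 2 v) {N₀ N₂ : ℝ} (k0 : ∀ y, ‖v y‖ ≤ N₀) (k2 : ∀ y, ‖iteratedFDeriv ℝ 2 v y‖ ≤ N₂) (x : EuclideanSpace ℝ (Fin 3)) :
    fracLapHalf (fun y => a y • v y) x = a x • fracLapHalf v x + lamComm a v x := by
  rw [lamComm_eq]; exact fracLapHalf_smul_eq ha hac hv k0 k2 x


end Summit.NavierStokesRegularity.NavierStokesRegularity.Theorems.CriticalFluxDoorLambdaSymmetry

end
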